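/-
Copyright (c) 2026 the pub-hodgecm-mathlib formalisation cell (harness21).  Prover seat hodgecm-mathlib-K2E3-p21 (g6), Track B «K2-LIT» ∕ h413
(`stmt-HodgeConjecture-24833`), line `K2_E3_EllipticInputs`, leaf (nsc-S-A′), brick GEO-QB (dealer D92; architect MEMO-SA-architecture v2 §3), part (G2).  2026-09-04.
-/
import Summits.HodgeConjecture.HodgeConjecture.Theorems.K2E3ParabolicCellCoinvariantsBound   -- (G1) (this seat): upper bound per `(P_c,B)`-cell
import Summits.HodgeConjecture.HodgeConjecture.Theorems.K2E3BorelCellJacquetLine             -- ★ E3γ2 (K2E3-p25 g0): the Borel case; `ker_restrictUnipotentGL_eq`, torus lemmas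
import HarnessLib

/-!
# K2_E3 road (h413), leaf (nsc-S-A′), brick GEO-QB (G2) — the `(P_c, B)` Bruhat filtration of `Ind_{P_c}^{GL_n} σ′`: ONE CELL CONTRIBUTES EXACTLY A LINE to the Borel
# Jacquet module, with its character (★ E3γ2 `K2E3BorelCellJacquetLine` generalised from the Borel `P_{id}` to a standard parabolic `P_c`, `c` monotone)

Cell `pub/hodgecm-mathlib` (D-0151), Track B, seat K2E3-p21 (g6).  `--supports stmt-HodgeConjecture-24833 --as helper`; THEOREMS ONLY; generic `n`, generic monotone labelling
`c`; COUNT-NEUTRAL.  Consumer: GEO-QB (G3) `K2E3GL3StandardModuleJacquetDimension` (`finrank (r_B (D η ψ)) = 3`), the honest extra input of C1′∕C2 (MEMO v2 §3).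
MATHEMATICS ([BernsteinZelevinsky1977, Prop. 1.9 (a), Thm. 5.2]; [Casselman1995, §6.3, Lemma 7.1.1]).  Notation of (G1): `P_c` standard parabolic, `U = U_n`, `σ′` smooth on `ℂ`,
`I = Ind_{P_c}^G σ′`, cell `P_c P_w U`, cell datum `(S, Γ, proj)`, `X^< = vanishingOn (cellLT c w) ≥ X^≤`, `J = r_U(I)` (★ `restrictUnipotentGL F id`), `F^< = [X^<] ≥ F^≤`.
The ONE change from the Borel case: the hypothesis `hΓlow` puts `P_w Γ P_w⁻¹` inside the radical `U_c⁻ = unipotentRadicalGL F (toDual ∘ c)` OPPOSITE to `P_c` (for `c = id` the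
lower unitriangular group), and §1 is `P_c ∩ U_c⁻ = 1`; the Iwahori factorisation ★ `exists_parabolic_mul_lower_of_mem_congruenceGL` is already stated for a general `c`.
* §1 `eq_one_of_mem_parabolic_of_mem_opposite` — `P_c ∩ U_c⁻ = 1`; `mul_blockDiagonalGL_mem_cellsBelow` — the `(P_c,B)`-cells are right-`T`-stable.
* §2 `exists_congruenceGL_forall_apply_eq_one`, **`exists_section_cellFun_eq_indicator`** — for closed `Γ` with `P_w Γ P_w⁻¹ ⊆ U_c⁻` an `f₀ ∈ X^<` whose cell function
  `γ ↦ f₀(P_w γ)` is the indicator of a non-empty compact open `K₀ ⊆ Γ`.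
* §3 **`exists_lineFunctional_of_cellDatum`** — given a right Haar measure `μ` on `Γ` whose Haar functional on `X^<` is `U`-invariant (`hinv`) and `T`-equivariant with
  character `e` (`hT`): a functional `Λ̄` on `J` with `ker Λ̄ ∩ F^< = F^≤`, `Λ̄|_{F^<} ≠ 0`, `Λ̄(r(m) x) = c(m) Λ̄(x)` on `F^<` for `r = normalizedJacquetGL F id I`,
  `c = e · (δ_B^{1∕2} ∘ emb)⁻¹` — the per-step input of ★ E3α `finrank_weightSpace_eq_card_of_lineFiltration`.  Proofs = ★ E3γ2 token for token with `P_{id} ↦ P_c`.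
HONEST LABEL: HC_CM is proved only modulo the 7 printed citations (2 remaining named inputs: hLiu418 = stmt-HodgeConjecture-24832, h413 = stmt-HodgeConjecture-24833) until rung 0 closes.
## References
* [BernsteinZelevinsky1977] I. N. Bernstein, A. V. Zelevinsky, *Induced representations of reductive p-adic groups I*, Ann. Sci. ÉNS 10 (1977), Prop. 1.9 (a), §2.12, Thm. 5.2.
* [Casselman1995] W. Casselman, *Introduction to the theory of admissible representations of p-adic reductive groups* (draft 1995), Prop. 1.4.4, §6.3 (Thm. 6.3.5), Lemma 7.1.1.
-/

set_option autoImplicit false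
-- the mandated namespace repeats `HodgeConjecture.HodgeConjecture`, as in every `Theorems/*.lean` of this sub-problem
set_option linter.dupNamespace false

noncomputable section

open Module Set Function Representation MeasureTheory
open scoped MatrixGroups

namespace Summit.HodgeConjecture.HodgeConjecture.Cruxes.H413.K2E3ParabolicCellJacquetLine

open Literature.NumberTheory.Automorphic ValuativeRel
open Summit.HodgeConjecture.HodgeConjecture.Cruxes.H413

variable {F : Type} [Field F] [ValuativeRel F] [TopologicalSpace F] [IsNonarchimedeanLocalField F] {n : ℕ}

/-! ## §1 `P_c ∩ U_c⁻ = 1`; the cells are right-`T`-stable -/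
omit [ValuativeRel F] [TopologicalSpace F] [IsNonarchimedeanLocalField F] in
/-- A block upper triangular matrix (`∈ P_c`) lying in the opposite radical `U_c⁻` (block lower unitriangular) is the identity. [folklore] -/
theorem eq_one_of_mem_parabolic_of_mem_opposite {α : Type*} [LinearOrder α] (c : Fin n → α) {g : GL (Fin n) F} (hP : g ∈ standardParabolicGL F c)
    (hL : g ∈ unipotentRadicalGL F (⇑OrderDual.toDual ∘ c)) : g = 1 := by
  rw [mem_unipotentRadicalGL_iff_entry] at hL
  apply Units.ext
  ext i j
  rcases lt_trichotomy (c i) (c j) with hij | hij | hij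
  · -- an entry above the diagonal blocks of a matrix in `U_c⁻`
    have := hL.1 (show (⇑OrderDual.toDual ∘ c) j < (⇑OrderDual.toDual ∘ c) i from hij)
    rw [this, Units.val_one, Matrix.one_apply_ne fun h => (ne_of_lt hij) (congrArg c h)]
  · rw [hL.2 i j hij, Units.val_one]
  · have := (mem_standardParabolicGL_iff c g).1 hP hij
    rw [this, Units.val_one, Matrix.one_apply_ne fun h => (ne_of_gt hij) (congrArg c h)]

omit [ValuativeRel F] [TopologicalSpace F] [IsNonarchimedeanLocalField F] in
/-- **The `(P_c, B)` cells are right-`T`-stable**: `g ∈ cellsBelow c D ⇒ g · diag(m) ∈ cellsBelow c D` (`p P_τ u · t = (p · P_τ t P_τ⁻¹) P_τ (t⁻¹ u t)`, and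
`P_τ t P_τ⁻¹ ∈ B ≤ P_c` for monotone `c`). [cite: BernsteinZelevinsky1977, Thm. 5.2] -/
theorem mul_blockDiagonalGL_mem_cellsBelow {α : Type*} [LinearOrder α] [Fintype α] (c : Fin n → α) (hc : Monotone c) (D : Set (ℕ ×ₗ Lex (Fin n → α)))
    {g : GL (Fin n) F} (hg : g ∈ cellsBelow (K := F) c D) (m : Π a : Fin n, GL {i : Fin n // (id : Fin n → Fin n) i = a} F) :
    g * blockDiagonalGL F (id : Fin n → Fin n) m ∈ cellsBelow (K := F) c D := by
  obtain ⟨τ, hτ, p, hp, u, hu, rfl⟩ := hg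
  set t : GL (Fin n) F := blockDiagonalGL F (id : Fin n → Fin n) m with ht
  have htM : t ∈ standardLeviGL F (id : Fin n → Fin n) := ⟨m, rfl⟩
  have hconj : t⁻¹ * u * t ∈ upperUnitriangular (Fin n) F := by
    have := conj_mem_unipotentRadicalGL_of_mem_standardLeviGL (R := F) (c := (id : Fin n → Fin n)) (Subgroup.inv_mem _ htM) hu
    rwa [inv_inv] at this
  refine ⟨τ, hτ, p * ((permGL τ : GL (Fin n) F) * t * (permGL τ)⁻¹),
    Subgroup.mul_mem _ hp (borel_le_standardParabolicGL (R := F) hc (K2E3BorelCellJacquetLine.permGL_conj_blockDiagonalGL_mem_borel τ m)),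
    t⁻¹ * u * t, hconj, ?_⟩
  simp only [mul_assoc, inv_mul_cancel_left, mul_inv_cancel_left]

/-! ## §2 The section at `P_w` with indicator cell function -/
/-- A smooth one-dimensional representation of `P_c` is trivial on `P_c ∩ K` for every sufficiently small principal congruence subgroup `K`. [cite: Casselman1995, Prop. 1.4.4] -/
theorem exists_congruenceGL_forall_apply_eq_one {α : Type*} [LinearOrder α] (c : Fin n → α) (σ' : Representation ℂ ↥(standardParabolicGL F c) ℂ) (hσ' : σ'.IsSmooth) :
    ∃ γ : (ValueGroupWithZero F)ˣ, ∀ b : ↥(standardParabolicGL F c),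
      (b : GL (Fin n) F) ∈ congruenceGL n (γ : ValueGroupWithZero F) → σ' b = 1 := by
  haveI : IsTopologicalRing F := inferInstance
  obtain ⟨γ, hγ⟩ := exists_congruenceGL_subset_of_isOpen (H := standardParabolicGL F c) (T := σ'.stabilizerSubgroup (1 : ℂ)) (hσ' 1)
  refine ⟨γ, fun b hb => ?_⟩
  have h1 : σ' b 1 = 1 := (Representation.mem_stabilizerSubgroup _ _ _).1 (hγ b hb)
  refine LinearMap.ext fun z => ?_
  have : σ' b z = z * σ' b 1 := by rw [← smul_eq_mul, ← map_smul, smul_eq_mul, mul_one]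
  rw [this, h1, mul_one, Module.End.one_apply]

set_option maxHeartbeats 800000 in
/-- **THE SECTION AT `P_w` WITH INDICATOR CELL FUNCTION.**  `σ′` smooth on `ℂ`, `Γ ≤ G` a closed subgroup with `P_w Γ P_w⁻¹ ⊆ U_c⁻` (the radical opposite to `P_c`); then some `f₀ ∈ Ind_{P_c}^G σ′` vanishing on
`cellLT id w` has cell function `γ ↦ f₀(P_w γ)` equal to the indicator of a non-empty compact open `K₀ ⊆ Γ`.
[cite: BernsteinZelevinsky1977, §5 (5.2), Thm. 5.2] [cite: Casselman1995, Prop. 1.4.4, §6.3 (proof of Thm. 6.3.5)] -/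
theorem exists_section_cellFun_eq_indicator {α : Type*} [LinearOrder α] [Fintype α] (c : Fin n → α) (hc : Monotone c)
    (σ' : Representation ℂ ↥(standardParabolicGL F c) ℂ) (hσ' : σ'.IsSmooth)
    (w : Equiv.Perm (Fin n)) (Γ : Subgroup (GL (Fin n) F)) (hΓcl : IsClosed (Γ : Set (GL (Fin n) F)))
    (hΓlow : ∀ γ ∈ Γ, (permGL w : GL (Fin n) F) * γ * (permGL w)⁻¹ ∈ unipotentRadicalGL F (⇑OrderDual.toDual ∘ c)) :
    ∃ f₀ : SmoothInd (standardParabolicGL F c) σ',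
      f₀ ∈ vanishingOn (standardParabolicGL F c) σ' (cellLT (K := F) c w) ∧
      ∃ K₀ : Set ↥Γ, IsOpen K₀ ∧ IsCompact K₀ ∧ K₀.Nonempty ∧
        ∀ γ : ↥Γ, f₀.toFun ((permGL w : GL (Fin n) F) * (γ : GL (Fin n) F)) = K₀.indicator (fun _ => (1 : ℂ)) γ := by
  classical
  haveI : IsTopologicalRing F := inferInstance
  haveI : T2Space F := (Literature.NumberTheory.GaloisRepresentations.IsNonarchimedeanLocalField.isLocalField F).toT2Space
  -- (a) `σ′` trivial on `P_c ∩ K_{γa}`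
  obtain ⟨γa, hγa⟩ := exists_congruenceGL_forall_apply_eq_one c σ' hσ'
  -- (b) `K_{γb} · P_w` misses the closed `cellLT id w`
  have hPw : (permGL w : GL (Fin n) F) ∉ cellLT (K := F) c w := fun h =>
    Set.disjoint_left.1 (disjoint_cellLT_parabolicDoubleCoset (K := F) c hc w) h
      (permGL_mem_parabolicDoubleCoset (K := F) c w)
  have hnhds : {g : GL (Fin n) F | g * (permGL w : GL (Fin n) F) ∉ cellLT (K := F) c w} ∈ nhds (1 : GL (Fin n) F) := by
    refine ((isClosed_cellLT (K := F) c hc w).isOpen_compl.preimage (continuous_id.mul continuous_const)).mem_nhds ?_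
    simpa only [Set.mem_preimage, Set.mem_compl_iff, Pi.mul_apply, id_eq, one_mul] using hPw
  obtain ⟨γb, hγb⟩ := exists_congruenceGL_subset (n := n) (F := F) hnhds
  -- (c) some `γ₁ < 1`
  obtain ⟨ϖ, hϖ0, hϖ1⟩ := exists_valuation_pos_lt_one (F := F)
  set γ₁ : (ValueGroupWithZero F)ˣ := Units.mk0 (valuation F ϖ) hϖ0 with hγ₁
  -- the subgroup `K = K_γ`, `γ = min`
  set δ : (ValueGroupWithZero F)ˣ := min (min γa γb) γ₁ with hδ_def
  have hγa' : congruenceGL n (δ : ValueGroupWithZero F) ≤ congruenceGL n (γa : ValueGroupWithZero F) :=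
    congruenceGL_mono (Units.val_le_val.2 ((min_le_left _ _).trans (min_le_left _ _)))
  have hγb' : congruenceGL n (δ : ValueGroupWithZero F) ≤ congruenceGL n (γb : ValueGroupWithZero F) :=
    congruenceGL_mono (Units.val_le_val.2 ((min_le_left _ _).trans (min_le_right _ _)))
  have hγlt : (δ : ValueGroupWithZero F) < 1 :=
    lt_of_le_of_lt (Units.val_le_val.2 (min_le_right _ _)) (by rw [hγ₁, Units.val_mk0]; exact hϖ1)
  set K := congruenceGL n (δ : ValueGroupWithZero F) with hK_def
  have hKo : IsOpen (K : Set (GL (Fin n) F)) := isOpen_congruenceGL (Units.ne_zero δ)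
  have hKc : IsCompact (K : Set (GL (Fin n) F)) := isCompact_congruenceGL _
  -- (d) the section supported on `P_c · K`
  have hw1 : (1 : ℂ) ∈ σ'.fixedPoints (K.subgroupOf (standardParabolicGL F c)) := by
    rw [Representation.mem_fixedPoints]
    intro b hb
    rw [hγa b (hγa' (Subgroup.mem_subgroupOf.1 hb)), Module.End.one_apply]
  obtain ⟨f₁, -, -, hf₁in, hf₁out⟩ :=
    Representation.exists_mem_fixedPoints_toFun_eq_of_isOpen (H := standardParabolicGL F c) (σ := σ') hKo hw1
  -- `f₀ = P_w⁻¹ · f₁`, `f₀(x) = f₁(x P_w⁻¹)`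
  refine ⟨smoothIndRep (standardParabolicGL F c) σ' ((permGL w : GL (Fin n) F)⁻¹) f₁, ?_, ?_⟩
  · -- vanishing on `cellLT`: the support of `f₀` is `P_c K P_w`
    intro g hg
    rw [toFun_smoothIndRep_apply]
    apply hf₁out
    intro b κ hκ heq
    -- `g P_w⁻¹ = b κ` ⇒ `g = b (κ P_w)` ∈ `cellLT`, but `κ P_w ∉ cellLT`
    have hκb : κ * (permGL w : GL (Fin n) F) ∉ cellLT (K := F) c w := hγb (hγb' hκ)
    apply hκb
    have hg' : g = (b : GL (Fin n) F) * (κ * (permGL w : GL (Fin n) F)) := by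
      rw [← mul_assoc, ← heq, inv_mul_cancel_right]
    have hmem := mul_mul_mem_cellsBelow (K := F) c hg (Subgroup.inv_mem _ b.2) (Subgroup.one_mem (upperUnitriangular (Fin n) F))
    rw [hg', mul_one, inv_mul_cancel_left] at hmem
    exact hmem
  · -- the cell function: indicator of `K₀ = {γ : P_w γ P_w⁻¹ ∈ K}`
    set K₀ : Set ↥Γ := {γ | (permGL w : GL (Fin n) F) * (γ : GL (Fin n) F) * (permGL w)⁻¹ ∈ K} with hK₀_def
    have hconj : Continuous fun γ : ↥Γ => (permGL w : GL (Fin n) F) * (γ : GL (Fin n) F) * (permGL w)⁻¹ :=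
      (continuous_const.mul continuous_subtype_val).mul continuous_const
    refine ⟨K₀, hKo.preimage hconj, ?_, ⟨1, by simp [hK₀_def, K.one_mem]⟩, fun γ => ?_⟩
    · -- compactness: `K₀` is the preimage under the closed embedding `Γ ↪ G` of the compact `P_w⁻¹ K P_w`
      have hcpt : IsCompact ((fun g : GL (Fin n) F => (permGL w : GL (Fin n) F)⁻¹ * g * (permGL w : GL (Fin n) F)) '' (K : Set (GL (Fin n) F))) :=
        hKc.image ((continuous_const.mul continuous_id).mul continuous_const)
      have hK₀eq : K₀ = Subtype.val ⁻¹' ((fun g : GL (Fin n) F => (permGL w : GL (Fin n) F)⁻¹ * g * (permGL w : GL (Fin n) F)) '' (K : Set (GL (Fin n) F))) := by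
        ext γ
        simp only [hK₀_def, Set.mem_setOf_eq, Set.mem_preimage, Set.mem_image, SetLike.mem_coe]
        constructor
        · intro h
          exact ⟨_, h, by group⟩
        · rintro ⟨g, hg, hgγ⟩
          have : (permGL w : GL (Fin n) F) * (γ : GL (Fin n) F) * (permGL w)⁻¹ = g := by rw [← hgγ]; group
          rw [this]
          exact hg
      rw [hK₀eq]
      exact hΓcl.isClosedEmbedding_subtypeVal.isCompact_preimage hcpt
    · rw [toFun_smoothIndRep_apply]
      set y : GL (Fin n) F := (permGL w : GL (Fin n) F) * (γ : GL (Fin n) F) * (permGL w)⁻¹ with hy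
      have hyL : y ∈ unipotentRadicalGL F (⇑OrderDual.toDual ∘ c) := hΓlow γ γ.2
      by_cases hγK : γ ∈ K₀
      · rw [Set.indicator_of_mem hγK]
        have hyK : y ∈ K := hγK
        have := hf₁in 1 y hyK
        rwa [Subgroup.coe_one, one_mul, σ'.map_one, Module.End.one_apply] at this
      · rw [Set.indicator_of_notMem hγK]
        apply hf₁out
        intro b κ hκ hyeq
        apply hγK
        change y ∈ K
        -- Iwahori factorisation `κ = p u`, `p ∈ P_c ∩ K`, `u ∈ U_c⁻ ∩ K`
        obtain ⟨p, hpB, hpK, u, huL, huK, hκeq⟩ := exists_parabolic_mul_lower_of_mem_congruenceGL (F := F) c hγlt hκ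
        -- `b p = y u⁻¹ ∈ P_c ∩ U_c⁻ = 1`
        have h1 : (b : GL (Fin n) F) * p = y * u⁻¹ := by
          rw [hyeq, hκeq, ← mul_assoc, mul_inv_cancel_right]
        have hBU : (b : GL (Fin n) F) * p = 1 :=
          eq_one_of_mem_parabolic_of_mem_opposite c (Subgroup.mul_mem _ b.2 hpB) (by rw [h1]; exact Subgroup.mul_mem _ hyL (Subgroup.inv_mem _ huL))
        have hyu : y = u := mul_inv_eq_one.1 (h1.symm.trans hBU)
        rw [hyu]
        exact huK


/-! ## §3 The line functional on `r_U(I)` attached to a cell datum with a `U`-invariant, `T`-equivariant Haar functional -/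
section Line

variable {α : Type*} [LinearOrder α] [Fintype α] (c : Fin n → α) (hc : Monotone c) (σ' : Representation ℂ ↥(standardParabolicGL F c) ℂ)
  (w : Equiv.Perm (Fin n)) (Γ S : Subgroup (GL (Fin n) F))
include hc in

set_option maxHeartbeats 1600000 in
/-- **ONE CELL CONTRIBUTES EXACTLY A LINE, WITH ITS CHARACTER** (the per-step input of ★ E3α).  Data: a cell datum `(S, Γ, proj)` for `w` as in ★ E3γ1 with `Γ` closed and
`P_w Γ P_w⁻¹ ⊆ U_c⁻`; `σ′` smooth on `ℂ`; a right-invariant measure `μ` on `Γ`, finite on compacts and positive on opens; HYPOTHESES (the per-cell group theory, discharged in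
the cell-data bricks): (`hinv`) the Haar functional `Λ₀ f = ∫ f(P_w γ) dμ(γ)` on `X^< = vanishingOn (cellLT id w)` is invariant under right translation by `U`; (`hT`) it is
`e`-equivariant under right translation by the torus `blockDiagonalGL F id m`.  CONCLUSION: there is a linear functional `Λ̄` on `J = r_U(Ind_B σ′)` (★ `restrictUnipotentGL`
carrier) such that, with `F^< = [X^<] ≥ F^≤ = [X^≤]`:  `Λ̄ x = 0 ↔ x ∈ F^≤` for `x ∈ F^<`;  `Λ̄ ≠ 0` on `F^<`;  and `Λ̄ (r(m) x) = c(m) Λ̄ x` on `F^<` for the NORMALISED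
Jacquet action `r = normalizedJacquetGL F id (Ind_B σ′)` and `c = e · (δ_B^{1∕2} ∘ emb)⁻¹`.
[cite: BernsteinZelevinsky1977, Prop. 1.9 (a), §2.3, Thm. 5.2] [cite: Casselman1995, §6.3 Thm. 6.3.5, Lemma 7.1.1] -/
theorem exists_lineFunctional_of_cellDatum (hσ' : σ'.IsSmooth) (hΓU : Γ ≤ upperUnitriangular (Fin n) F) (hΓcl : IsClosed (Γ : Set (GL (Fin n) F)))
    (hΓlim : IsLimitOfCompactOpen ↥Γ)
    (hΓlow : ∀ γ ∈ Γ, (permGL w : GL (Fin n) F) * γ * (permGL w)⁻¹ ∈ unipotentRadicalGL F (⇑OrderDual.toDual ∘ c))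
    (hS : ∀ u ∈ upperUnitriangular (Fin n) F,
      (permGL w : GL (Fin n) F) * u * (permGL w)⁻¹ ∈ standardParabolicGL F c → u ∈ S)
    (hSB : ∀ s ∈ S, (permGL w : GL (Fin n) F) * s * (permGL w)⁻¹ ∈ standardParabolicGL F c)
    (hdec : ∀ u ∈ upperUnitriangular (Fin n) F, ∃ s ∈ S, ∃ γ ∈ Γ, u = s * γ)
    (proj : ↥(upperUnitriangular (Fin n) F) → ↥Γ) (hproj : Continuous proj)
    (hprojS : ∀ (s : GL (Fin n) F) (hs : s ∈ upperUnitriangular (Fin n) F) (_ : s ∈ S) (γ : ↥Γ),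
      proj ⟨s * γ, Subgroup.mul_mem _ hs (hΓU γ.2)⟩ = γ)
    [MeasurableSpace ↥Γ] [BorelSpace ↥Γ] (μ : Measure ↥Γ) [IsFiniteMeasureOnCompacts μ] [μ.IsMulRightInvariant] [μ.IsOpenPosMeasure]
    (hinv : ∀ u ∈ upperUnitriangular (Fin n) F, ∀ f ∈ vanishingOn (standardParabolicGL F c) σ' (cellLT (K := F) c w),
      ∫ γ, (smoothIndRep (standardParabolicGL F c) σ' u f).toFun ((permGL w : GL (Fin n) F) * ((γ : ↥Γ) : GL (Fin n) F)) ∂μ =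
        ∫ γ, f.toFun ((permGL w : GL (Fin n) F) * ((γ : ↥Γ) : GL (Fin n) F)) ∂μ)
    (e : (Π a : Fin n, GL {i : Fin n // (id : Fin n → Fin n) i = a} F) →* ℂˣ)
    (hT : ∀ (m : Π a : Fin n, GL {i : Fin n // (id : Fin n → Fin n) i = a} F),
      ∀ f ∈ vanishingOn (standardParabolicGL F c) σ' (cellLT (K := F) c w),
      ∫ γ, (smoothIndRep (standardParabolicGL F c) σ' (blockDiagonalGL F (id : Fin n → Fin n) m) f).toFun
          ((permGL w : GL (Fin n) F) * ((γ : ↥Γ) : GL (Fin n) F)) ∂μ =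
        ((e m : ℂˣ) : ℂ) * ∫ γ, f.toFun ((permGL w : GL (Fin n) F) * ((γ : ↥Γ) : GL (Fin n) F)) ∂μ) :
    let I := smoothIndRep (standardParabolicGL F c) σ'
    let mk := Coinvariants.mk (restrictUnipotentGL F (id : Fin n → Fin n) I)
    let Flt := (vanishingOn (standardParabolicGL F c) σ' (cellLT (K := F) c w)).map mk
    let Fle := (vanishingOn (standardParabolicGL F c) σ' (cellLE (K := F) c w)).map mk
    ∃ Λ : (restrictUnipotentGL F (id : Fin n → Fin n) I).Coinvariants →ₗ[ℂ] ℂ,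
      (∀ x ∈ Flt, Λ x = 0 ↔ x ∈ Fle) ∧ (∃ x ∈ Flt, Λ x ≠ 0) ∧
      ∀ (m : Π a : Fin n, GL {i : Fin n // (id : Fin n → Fin n) i = a} F), ∀ x ∈ Flt,
        Λ (Representation.normalizedJacquetGL F (id : Fin n → Fin n) I m x) =
          (((e * ((rootDeltaChar (standardParabolicGL F (id : Fin n → Fin n))).comp (leviEmbeddingP F (id : Fin n → Fin n)))⁻¹) m : ℂˣ) : ℂ) * Λ x := by
  intro I mk Flt Fle
  haveI : IsTopologicalRing F := inferInstance
  let P := standardParabolicGL F c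
  let B := standardParabolicGL F (id : Fin n → Fin n)
  let Xlt := vanishingOn P σ' (cellLT (K := F) c w)
  let Xle := vanishingOn P σ' (cellLE (K := F) c w)
  have hle : Xle ≤ Xlt := vanishingOn_mono (cellLT_subset_cellLE (K := F) c w)
  have hFle : Fle ≤ Flt := Submodule.map_mono hle
  -- the cell function and the Haar functional `Λ₀` on `X^<`
  have hcont : ∀ f : SmoothInd P σ', Continuous fun γ : ↥Γ => f.toFun ((permGL w : GL (Fin n) F) * ((γ : ↥Γ) : GL (Fin n) F)) := fun f =>
    SmoothInd.continuous_cellFun P σ' Γ.subtype (permGL w : GL (Fin n) F) continuous_subtype_val f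
  have hint : ∀ f ∈ Xlt, Integrable (fun γ : ↥Γ => f.toFun ((permGL w : GL (Fin n) F) * ((γ : ↥Γ) : GL (Fin n) F))) μ := fun f hf =>
    (hcont f).integrable_of_hasCompactSupport (K2E3ParabolicCellCoinvariantsBound.hasCompactSupport_cellFun_of_mem_vanishingOn_cellLT c σ' w Γ S hc hΓU hS proj hproj hprojS f hf)
  let Λ₀ : ↥Xlt →ₗ[ℂ] ℂ :=
    { toFun := fun f => ∫ γ, (f : SmoothInd P σ').toFun ((permGL w : GL (Fin n) F) * ((γ : ↥Γ) : GL (Fin n) F)) ∂μ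
      map_add' := fun f g => by
        simp only [Submodule.coe_add, SmoothInd.toFun_add, Pi.add_apply]
        exact integral_add (hint f.1 f.2) (hint g.1 g.2)
      map_smul' := fun c f => by
        simp only [Submodule.coe_smul, SmoothInd.toFun_smul, Pi.smul_apply, RingHom.id_apply]
        exact integral_smul c _ }
  have hΛ₀ : ∀ f : ↥Xlt, Λ₀ f = ∫ γ, (f : SmoothInd P σ').toFun ((permGL w : GL (Fin n) F) * ((γ : ↥Γ) : GL (Fin n) F)) ∂μ := fun _ => rfl
  -- `Λ₀` kills `X^≤`
  have hΛ₀le : ∀ f : ↥Xlt, (f : SmoothInd P σ') ∈ Xle → Λ₀ f = 0 := by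
    intro f hf
    rw [hΛ₀]
    have : (fun γ : ↥Γ => (f : SmoothInd P σ').toFun ((permGL w : GL (Fin n) F) * ((γ : ↥Γ) : GL (Fin n) F))) = fun _ => 0 := by
      funext γ
      exact hf _ ⟨w, Set.mem_Iic.2 le_rfl, 1, Subgroup.one_mem _, γ, hΓU γ.2, by rw [one_mul]⟩
    rw [this, integral_zero]
  -- `Λ₀` is `U`-invariant, hence kills the vectors of `X^<` with zero class in `J` (★ left exactness)
  let ρU : Representation ℂ ↥(upperUnitriangular (Fin n) F) (SmoothInd P σ') := I.comp (upperUnitriangular (Fin n) F).subtype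
  have hρU : ρU.IsSmooth := (isSmooth_smoothInd P σ').comp _ continuous_subtype_val
  have hstabU : ∀ (u : ↥(upperUnitriangular (Fin n) F)) ⦃f : SmoothInd P σ'⦄, f ∈ Xlt → ρU u f ∈ Xlt := fun u f hf =>
    K2E3ParabolicCellCoinvariantsBound.smoothIndRep_mem_vanishingOn_cellsBelow c σ' _ u.2 hf
  have hΛ₀inv : ∀ (u : ↥(upperUnitriangular (Fin n) F)) (f : ↥Xlt), Λ₀ ⟨ρU u f, hstabU u f.2⟩ = Λ₀ f := fun u f => hinv u u.2 f f.2
  have hΛ₀ker : ∀ f : ↥Xlt, mk (f : SmoothInd P σ') = 0 → Λ₀ f = 0 := by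
    intro f hf
    have hf' : Coinvariants.mk ρU (f : SmoothInd P σ') = 0 := by
      rw [Coinvariants.mk_eq_zero] at hf ⊢
      rw [K2E3BorelCellJacquetLine.ker_restrictUnipotentGL_eq (id : Fin n → Fin n) I] at hf
      exact hf
    exact apply_eq_zero_of_mk_coinvariants_eq_zero (isLimitOfCompactOpen_upperUnitriangular F n) hρU Xlt hstabU Λ₀ hΛ₀inv f hf'
  -- descend `Λ₀` to `F^< = range (mk ∘ X^<.subtype)` and extend to `J`
  let φ : ↥Xlt →ₗ[ℂ] (restrictUnipotentGL F (id : Fin n → Fin n) I).Coinvariants := mk ∘ₗ Xlt.subtype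
  have hφrange : LinearMap.range φ = Flt := by rw [LinearMap.range_comp, Submodule.range_subtype]
  have hkerφ : LinearMap.ker φ ≤ LinearMap.ker Λ₀ := fun f hf => by
    rw [LinearMap.mem_ker] at hf ⊢
    exact hΛ₀ker f hf
  let Λq : (↥Xlt ⧸ LinearMap.ker φ) →ₗ[ℂ] ℂ := (LinearMap.ker φ).liftQ Λ₀ hkerφ
  let ΛR : ↥(LinearMap.range φ) →ₗ[ℂ] ℂ := Λq ∘ₗ (φ.quotKerEquivRange.symm : ↥(LinearMap.range φ) →ₗ[ℂ] (↥Xlt ⧸ LinearMap.ker φ))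
  obtain ⟨g, hg⟩ := LinearMap.exists_leftInverse_of_injective (LinearMap.range φ).subtype (Submodule.ker_subtype _)
  let Λ : (restrictUnipotentGL F (id : Fin n → Fin n) I).Coinvariants →ₗ[ℂ] ℂ := ΛR ∘ₗ g
  have hΛφ : ∀ f : ↥Xlt, Λ (φ f) = Λ₀ f := by
    intro f
    have hmem : φ f ∈ LinearMap.range φ := LinearMap.mem_range_self φ f
    have hgf : g (φ f) = ⟨φ f, hmem⟩ := by
      have := LinearMap.congr_fun hg ⟨φ f, hmem⟩
      simpa using this
    change ΛR (g (φ f)) = Λ₀ f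
    rw [hgf]
    change Λq (φ.quotKerEquivRange.symm ⟨φ f, hmem⟩) = Λ₀ f
    rw [LinearMap.quotKerEquivRange_symm_apply_image, Submodule.mkQ_apply, Submodule.liftQ_apply]
  have hΛmk : ∀ f (hf : f ∈ Xlt), Λ (mk f) = Λ₀ ⟨f, hf⟩ := fun f hf => hΛφ ⟨f, hf⟩
  -- (e) `Λ` kills `F^≤`
  have hΛle : ∀ x ∈ Fle, Λ x = 0 := by
    rintro _ ⟨f, hf, rfl⟩
    rw [hΛmk f (hle hf)]
    exact hΛ₀le ⟨f, hle hf⟩ hf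
  -- (f) `Λ ≠ 0` on `F^<`: the section `f₀`
  obtain ⟨f₀, hf₀, K₀, hK₀o, hK₀c, hK₀n, hf₀cell⟩ := exists_section_cellFun_eq_indicator c hc σ' hσ' w Γ hΓcl hΓlow
  have hΛf₀ : Λ (mk f₀) ≠ 0 := by
    rw [hΛmk f₀ hf₀, hΛ₀]
    change ∫ γ, f₀.toFun ((permGL w : GL (Fin n) F) * ((γ : ↥Γ) : GL (Fin n) F)) ∂μ ≠ 0
    rw [show (fun γ : ↥Γ => f₀.toFun ((permGL w : GL (Fin n) F) * ((γ : ↥Γ) : GL (Fin n) F))) = K₀.indicator (fun _ => (1 : ℂ)) from funext hf₀cell,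
      integral_indicator_const (1 : ℂ) hK₀o.measurableSet]
    refine smul_ne_zero ?_ one_ne_zero
    rw [Measure.real, Ne, ENNReal.toReal_eq_zero_iff, not_or]
    exact ⟨hK₀o.measure_ne_zero μ hK₀n, (hK₀c.measure_lt_top (μ := μ)).ne⟩
  -- (g) `ker Λ ∩ F^< = F^≤`: `F^< ⁄ F^≤` has dimension `≤ 1` (★ E3γ1) and `Λ` induces a non-zero functional on it
  obtain ⟨hfdQ, hdimQ⟩ := K2E3ParabolicCellCoinvariantsBound.finrank_quot_le_one_of_cellDatum c σ' w Γ S hc hΓU hΓlim hS hSB hdec proj hproj hprojS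
  have hker : ∀ x ∈ Flt, Λ x = 0 ↔ x ∈ Fle := by
    intro x hx
    refine ⟨fun hx0 => ?_, fun hx' => hΛle x hx'⟩
    -- the induced functional on the quotient `Q = F^< ⁄ F^≤`
    let Fle' : Submodule ℂ ↥Flt := Fle.comap Flt.subtype
    have hΛFle' : Fle' ≤ LinearMap.ker (Λ ∘ₗ Flt.subtype) := fun y hy => by
      rw [LinearMap.mem_ker, LinearMap.comp_apply, Submodule.coe_subtype]
      exact hΛle _ hy
    let ΛQ : (↥Flt ⧸ Fle') →ₗ[ℂ] ℂ := Fle'.liftQ (Λ ∘ₗ Flt.subtype) hΛFle'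
    have hΛQ_mk : ∀ y : ↥Flt, ΛQ (Submodule.Quotient.mk y) = Λ y := fun _ => rfl
    -- `ΛQ ≠ 0`, `dim Q ≤ 1` ⇒ `ΛQ` injective
    haveI := hfdQ
    have hQ0 : ΛQ (Submodule.Quotient.mk ⟨mk f₀, f₀, hf₀, rfl⟩) ≠ 0 := by rw [hΛQ_mk]; exact hΛf₀
    have hΛQinj : Function.Injective ΛQ := by
      -- a non-zero linear functional on a space of dimension `≤ 1` is injective
      have hrange : LinearMap.range ΛQ = ⊤ := by
        rw [eq_top_iff]
        intro z _
        have hq0 : ΛQ (Submodule.Quotient.mk ⟨mk f₀, f₀, hf₀, rfl⟩) ≠ 0 := hQ0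
        refine ⟨(z / ΛQ (Submodule.Quotient.mk ⟨mk f₀, f₀, hf₀, rfl⟩)) • Submodule.Quotient.mk ⟨mk f₀, f₀, hf₀, rfl⟩, ?_⟩
        rw [map_smul, smul_eq_mul, div_mul_cancel₀ _ hq0]
      have hdim1 : finrank ℂ (↥Flt ⧸ Fle') = 1 := by
        have h1 : 1 ≤ finrank ℂ (↥Flt ⧸ Fle') := by
          have := LinearMap.finrank_range_le ΛQ
          rw [hrange, finrank_top, Module.finrank_self] at this
          exact this
        exact le_antisymm hdimQ h1
      exact LinearMap.injective_iff_surjective_of_finrank_eq_finrank (by rw [hdim1, Module.finrank_self]) |>.2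
        (LinearMap.range_eq_top.1 hrange)
    have hxq : ΛQ (Submodule.Quotient.mk ⟨x, hx⟩) = 0 := by rw [hΛQ_mk]; exact hx0
    have hx0' : (Submodule.Quotient.mk ⟨x, hx⟩ : ↥Flt ⧸ Fle') = 0 := hΛQinj (by rw [hxq, map_zero])
    rw [Submodule.Quotient.mk_eq_zero] at hx0'
    exact hx0'
  -- (h) equivariance under the normalised torus action
  have hequiv : ∀ (m : Π a : Fin n, GL {i : Fin n // (id : Fin n → Fin n) i = a} F), ∀ x ∈ Flt,
      Λ (Representation.normalizedJacquetGL F (id : Fin n → Fin n) I m x) =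
        (((e * ((rootDeltaChar B).comp (leviEmbeddingP F (id : Fin n → Fin n)))⁻¹) m : ℂˣ) : ℂ) * Λ x := by
    rintro m _ ⟨f, hf, rfl⟩
    have hfm : I (blockDiagonalGL F (id : Fin n → Fin n) m) f ∈ Xlt :=
      smoothIndRep_apply_mem_vanishingOn (fun g hg => mul_blockDiagonalGL_mem_cellsBelow c hc _ hg m) hf
    have h1 : Representation.normalizedJacquetGL F (id : Fin n → Fin n) I m (mk f) =
        (((rootDeltaChar B (leviEmbeddingP F (id : Fin n → Fin n) m))⁻¹ : ℂˣ) : ℂ) • mk (I (blockDiagonalGL F (id : Fin n → Fin n) m) f) := rfl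
    rw [h1, map_smul, hΛmk _ hfm, hΛmk f hf, hΛ₀, hΛ₀, smul_eq_mul]
    change _ * ∫ γ, (smoothIndRep P σ' (blockDiagonalGL F (id : Fin n → Fin n) m) f).toFun _ ∂μ = _
    rw [hT m f hf, MonoidHom.mul_apply, MonoidHom.inv_apply, Units.val_mul, MonoidHom.coe_comp, Function.comp_apply]
    ring
  exact ⟨Λ, hker, ⟨mk f₀, ⟨f₀, hf₀, rfl⟩, hΛf₀⟩, hequiv⟩
end Line

end Summit.HodgeConjecture.HodgeConjecture.Cruxes.H413.K2E3ParabolicCellJacquetLine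

end
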